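import Mathlib
import HarnessLib
import Literature.NumberTheory.DiophantineGeometry.AbcWave0
import Literature.NumberTheory.EllipticCurves.PastenCongruenceModulusSizeProofs
import Literature.NumberTheory.EllipticCurves.DeligneHeckeEigenvalueBound
import Literature.NumberTheory.EllipticCurves.NewformsLevelRaising
import Summits.ABC.ABC.Theorems.CongruentialReceptacleReceptacleIdentityStubExistsMonicNatDegree
import Summits.ABC.ABC.Theorems.CongruentialReceptacleReceptacleIdentityStubEvalWindow
import Summits.ABC.ABC.Theorems.CongruentialReceptacleReceptacleIdentityStubHasseWindowArith
import Summits.ABC.ABC.Theorems.CongruentialReceptacleReceptacleIdentityStubFinrankMono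
import Summits.ABC.ABC.Theorems.CongruentialReceptacleReceptacleIdentityStubDepthCostsHasseWindowOfFacts

/-!
# Line `Sketch` — proof skeleton for crux `ReceptacleIdentity` (stmt-ABC-1813), typed target C⁺

Route `CongruentialReceptacle`, crux stmt-ABC-1813 `ReceptacleIdentity` is INFORMAL (no decl in the
Theses file), so no skeleton can conclude it by name.  This line (card
`hasse-window-deep-level-lowering`, crux-ideate k = 1) is therefore registered against its own
typed target **C⁺ = `DepthCostsHasseWindow`** (the card's `Transfer`), rebuilt by the line lead
(prover-line-stmt-ABC-1813-0, 2026-08-16) over TREE vocabulary only: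

* the Hecke ring `𝕋(L) = anemicHeckeRing L 2 = ℤ[T_q : q ∤ L] ⊆ End_ℂ S₂(Γ₀(L))` and
  `anemicHeckeRing.T` (`HeckeCongruenceModulus.lean`), the Hecke operator `heckeT`
  (`HeckeOperators.lean`), Shimura's `T_p`-stable real lattice (`exists_heckeStable_realBasis`) and
  the charpoly mechanism of `PastenCongruenceModulusSizeProofs.lean`;
* Deligne's weight-2 bound `Deligne1974_heckeT_eigenvalue_norm_le` (named fact, in tree, unproved);
* elementary abc currency (`IsABCTriple`, `rad`, `Nat.factorization`): for the Frey curve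
  `E_(a,b)` in Serre's normalisation (`a ≡ 3 mod 4`, `32 ∣ b`) one has `N = rad(abc)`,
  `2⁸ Δ_min = (abc)²`, so `v_p(Δ_min) = 2·v_p(abc)` at odd `p`.

MECHANISM (card, First lemma): a ring map `θ : 𝕋(L) → ℤ/m` with `θ(T_p) = x`, `|x| > B ≥` every
eigenvalue of `T_p` on `S₂(Γ₀(L))`, forces `m ≤ (|x| + B)^{rank}` — Cayley–Hamilton for the integer
matrix of `T_p` on Shimura's lattice gives a monic `q ∈ ℤ[X]`, `q(T_p) = 0`, all complex roots of
norm `≤ B`, so `m ∣ q(x) ≠ 0` and `|q(x)| ≤ (|x|+B)^{deg q}`.  With `x = ε(p+1)` (`ε = a_p(E) = ±1`,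
the Tate-curve trace of `Frob_p` on `E[ℓⁿ]` unramified at `p`), `B = 2√p` (Deligne) and
`m = ℓⁿ ∣ v_p(Δ_min)` (deep level lowering supplies `θ` at a level `L`, `N/p ∣ L ∣ (N/p)²`), this
reads `ℓⁿ ≤ (1+√p)^{2·rank}`: **the ℓ-adic DEPTH of `v_p(Δ_min)` costs a Hasse window**.

STUBS (registered): `stub_existsMonicNatDegree` (lead; Hecke core), `stub_evalWindow`,
`stub_hasseWindowArith`, `stub_finrankMono` (workers; elementary) — all four LANDED 2026-08-16
(p96977, p96703, p96569, p96821) and wired in below — and two NAMED-FACT stubs not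
meant for workers (the only remaining `sorry`s): `stub_deligneWeightTwo` (= the tree's named fact, to be discharged under
Literature) and `stub_freyDeepLevelLoweringTrace` (deep level lowering mod `ℓⁿ` + Tate trace for
Frey curves: Dummigan 2015 / Fakhruddin–Khare–Ramakrishna 2021 / Wiles 1995 `R_Σ ≅ 𝕋_Σ`; to be
vendored under Literature); plus the CONDITIONAL COMPOSITION registered as a stub,
`stub_depthCostsHasseWindowOfFacts` (Deligne → deep level lowering → C⁺, carrying the First lemma
`modulus_le_pow_of_ringHom`), so that `DepthCostsHasseWindow_of` is one line.

HONEST REACH (card §Transfer, PICKED.md): C⁺ weighs `log v_p(Δ_min)` (the T(E)-channel), not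
`v_p(Δ_min)·log p`; it does not give `BalancedFreySzpiro`.
-/

-- `Summit.<Summit>.<Problem>` is the mandated summit-side namespace (CONVENTIONS §2); for the
-- single-conjunct summit `ABC` the two coincide, so the duplicate `ABC.ABC` is deliberate.
set_option linter.dupNamespace false

namespace Summit.ABC.ABC.Cruxes.ReceptacleIdentity.Sketch

open Polynomial CongruenceSubgroup
open scoped MatrixGroups ModularForm
open Literature.NumberTheory.DiophantineGeometry (IsABCTriple rad)
open Literature.NumberTheory.EllipticCurves.ModularForms

noncomputable section

/-! ### The typed target C⁺ -/

/-- **C⁺ — depth costs a Hasse window** (the line's typed target; card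
`hasse-window-deep-level-lowering`, §Transfer).  For an abc-triple in Serre's normalisation
(`a ≡ 3 (mod 4)`, `32 ∣ b`, so that the Frey curve `E_(a,b)` is semistable with `N = rad(abc)` and
`v_p(Δ_min) = 2 v_p(abc)` at odd `p`), an odd prime `p ∣ abc`, a prime `ℓ ≥ 5` with `ℓ ∤ abc`, and
`ℓⁿ ∣ v_p(abc)`: `ℓⁿ ≤ (1 + √p)^(2 · rank_ℝ S₂(Γ₀((N/p)²)))`. -/
def DepthCostsHasseWindow : Prop :=
  ∀ a b c : ℕ, IsABCTriple a b c → a % 4 = 3 → 32 ∣ b →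
    ∀ p : ℕ, p.Prime → p ≠ 2 → p ∣ a * b * c →
    ∀ ℓ : ℕ, ℓ.Prime → 5 ≤ ℓ → ¬ ℓ ∣ a * b * c →
    ∀ n : ℕ, ℓ ^ n ∣ (a * b * c).factorization p →
      ((ℓ ^ n : ℕ) : ℝ) ≤
        (1 + Real.sqrt p) ^ (2 * Module.finrank ℝ (CuspForm (Gamma0 ((rad a b c / p) ^ 2)) 2))

/-! ### Registered stubs (self-contained statements over tree vocabulary) -/

/-- **Stub (lead) — Hecke core with degree.**  `T_p` on `S_k(Γ₀(N))` is killed by a MONIC integer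
polynomial of degree `rank_ℝ S_k(Γ₀(N))` all of whose complex roots obey any common bound `B` for
the eigenvalues of `T_p` (Shimura 1971 Thm 3.48: charpoly of the integer matrix of `T_p` on the
`T_p`-stable lattice spanned by a real basis; cf. `exists_monic_aeval_heckeT_eq_zero`, which
hides the degree). -/
theorem stub_existsMonicNatDegree (N : ℕ) [NeZero N] (k : ℤ) (p : ℕ) [NeZero p] (hp : p.Prime)
    {B : ℝ} (hB : ∀ μ : ℂ, Module.End.HasEigenvalue (heckeT (Gamma0 N) k p) μ → ‖μ‖ ≤ B) :
    ∃ q : ℤ[X], q.Monic ∧ q.natDegree = Module.finrank ℝ (CuspForm (Gamma0 N) k) ∧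
      aeval (heckeT (Gamma0 N) k p) q = 0 ∧
      ∀ μ : ℂ, (q.map (Int.castRingHom ℂ)).IsRoot μ → ‖μ‖ ≤ B :=
  -- LANDED: Theorems/CongruentialReceptacleReceptacleIdentityStubExistsMonicNatDegree.lean (p96977)
  Summit.ABC.ABC.Theorems.ReceptacleIdentitySketch.stub_existsMonicNatDegree N k p hp hB

/-- **Stub — the evaluation window.**  A monic `q ∈ ℤ[X]` whose complex roots have norm `≤ B`
does not vanish at an integer `x` with `|x| > B`, and `|q(x)| ≤ (|x| + B)^{deg q}`. -/
theorem stub_evalWindow {q : ℤ[X]} (hq : q.Monic) {B : ℝ} (hB : 0 ≤ B)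
    (hroot : ∀ μ : ℂ, (q.map (Int.castRingHom ℂ)).IsRoot μ → ‖μ‖ ≤ B) {x : ℤ}
    (hx : B < |(x : ℝ)|) :
    q.eval x ≠ 0 ∧ |((q.eval x : ℤ) : ℝ)| ≤ (|(x : ℝ)| + B) ^ q.natDegree :=
  -- LANDED: Theorems/CongruentialReceptacleReceptacleIdentityStubEvalWindow.lean (p96703)
  Summit.ABC.ABC.Theorems.ReceptacleIdentitySketch.stub_evalWindow hq hB hroot hx

/-- **Stub — Hasse-window arithmetic.** `2√p < p + 1` for `p ≥ 2`, and
`p + 1 + 2√p = (1 + √p)²`. -/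
theorem stub_hasseWindowArith (p : ℕ) (hp : 2 ≤ p) :
    2 * Real.sqrt p < (p : ℝ) + 1 ∧ (p : ℝ) + 1 + 2 * Real.sqrt p = (1 + Real.sqrt p) ^ 2 :=
  -- LANDED: Theorems/CongruentialReceptacleReceptacleIdentityStubHasseWindowArith.lean (p96569)
  Summit.ABC.ABC.Theorems.ReceptacleIdentitySketch.stub_hasseWindowArith p hp

/-- **Stub — the rank of `S_k(Γ₀(·))` is monotone in the level** (oldform inclusion
`iota M N 1`, injective). -/
theorem stub_finrankMono (M N : ℕ) [NeZero M] [NeZero N] (k : ℤ) (h : M ∣ N) :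
    Module.finrank ℝ (CuspForm (Gamma0 M) k) ≤ Module.finrank ℝ (CuspForm (Gamma0 N) k) :=
  -- LANDED: Theorems/CongruentialReceptacleReceptacleIdentityStubFinrankMono.lean (p96821)
  Summit.ABC.ABC.Theorems.ReceptacleIdentitySketch.stub_finrankMono M N k h

/-- **Stub (named fact, in tree, NOT for workers) — Deligne's bound**, weight-2 case used:
every eigenvalue of `T_p` on `S₂(Γ₀(N))`, `p ∤ N`, has norm `≤ 2√p`
(`Literature.NumberTheory.EllipticCurves.ModularForms.Deligne1974_heckeT_eigenvalue_norm_le`;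
Deligne 1974 Thm 8.2; discharge = a Literature `_holds`). -/
theorem stub_deligneWeightTwo : Deligne1974_heckeT_eigenvalue_norm_le := by
  sorry

/-- **Stub (named fact, NOT for workers) — deep level lowering mod `ℓⁿ`, trace form, for Frey
curves.**  Serre-normalised abc-triple, odd prime `p ∣ abc`, prime `ℓ ≥ 5`, `ℓ ∤ abc`, `n ≥ 1`,
`ℓⁿ ∣ v_p(abc)` (so `E_(a,b)[ℓⁿ]` is unramified at `p`: Tate curve, `v_p(Δ_min) = 2v_p(abc)`,
`ℓ ≠ p`; `ρ̄_{E,ℓ}` is absolutely irreducible: Mazur + full rational 2-torsion, Serre 1987 §4.1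
Prop 6): there is a level `L` with `N/p ∣ L ∣ (N/p)²` (`N = rad(abc)`), `p ∤ L`, and a ring map
`θ : 𝕋(L) = ℤ[T_q : q ∤ L | S₂(Γ₀(L))] → ℤ/ℓⁿ` with `θ(T_p) = ε(p+1)`, `ε = a_p(E) = ±1`
(the system of eigenvalues of `ρₙ = E[ℓⁿ]` realised at a `p`-free level).  DERIVATION MAP for
the seat that vendors it (each input a printed theorem): (1) `ρ̄ = E[ℓ]` is absolutely irreducible,
also on `G_{ℚ(√ℓ*)}` (semistable + full 2-torsion + Mazur, Serre 1987 §4.1 Prop 6; at `ℓ ∤ N` the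
inertia characters at `ℓ` rule out induction from `ℚ(√ℓ*)` for `ℓ ≥ 5`), modular (Wiles/BCDT), flat
at `ℓ`; (2) `ρₙ` is a deformation of `ρ̄` of DDT-type `Σ` (det `= ε`, flat at `ℓ`, minimally
ramified outside `Σ`) for `Σ := {q ∣ N, q ≠ p : ℓ ∣ v_q(Δ_min), ℓⁿ ∤ v_q(Δ_min)}` — at `p` and at the
`q` with `ℓⁿ ∣ v_q(Δ_min)` it is unramified (Tate curve, `ℓ ≠ q`), at `q` with `ℓ ∤ v_q` it is
minimal of type (c); (3) `R_Σ ≅ 𝕋_Σ` (Darmon–Diamond–Taylor 1997 Thm 3.42 = Wiles 1995 Thm 3.3 +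
Taylor–Wiles; `𝕋_Σ ⊆ ∏_{f ∈ N_Σ} O_f` generated by `T_q`, `q ∉ Σ ∪ {ℓ}`, `q ∤ N(ρ̄)`, all `f` of
weight 2, trivial character, level dividing `N_Σ = N(ρ̄)·∏_{q∈Σ} q²`), whence a ring map
`ℤ[T_q : q ∤ ℓ N_Σ | S₂(Γ₀(N_Σ))] → 𝕋_Σ → ℤ/ℓⁿ`, `T_q ↦ tr ρₙ(Frob_q)`; (4) `T_ℓ ∈ 𝕋'_𝔪`
(non-Eisenstein `𝔪`, `ℓ ∤ 2N_Σ`: trace of crystalline Frobenius on the Fontaine–Laffaille module of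
the `𝕋'_𝔪`-valued representation; DDT §4.2 / Wiles 1995 Ch. 2 §1), so the map extends to the full
anemic ring; (5) restriction along the oldform inclusion from `L := N_Σ · ∏_{q ≠ p, ℓⁿ ∣ v_q} q`
(`N/p ∣ L ∣ (N/p)²`, `p ∤ L`) to `N_Σ`; (6) `tr ρₙ(Frob_p) = ε(1+p)`, `ε = a_p(E) = ±1` (Tate
curve, Silverman ATAEC V.3/V.5).  Deep level lowering mod `ℓⁿ` in exactly this Hecke-map sense:
Dummigan 2015; quantitative versions: Fakhruddin–Khare–Ramakrishna, J. LMS 103 (2021). -/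
theorem stub_freyDeepLevelLoweringTrace :
    ∀ a b c : ℕ, IsABCTriple a b c → a % 4 = 3 → 32 ∣ b →
    ∀ (p : ℕ) (hp : p.Prime), p ≠ 2 → p ∣ a * b * c →
    ∀ ℓ : ℕ, ℓ.Prime → 5 ≤ ℓ → ¬ ℓ ∣ a * b * c →
    ∀ n : ℕ, 0 < n → ℓ ^ n ∣ (a * b * c).factorization p →
      ∃ (L : ℕ) (hL : NeZero L) (hpL : ¬ p ∣ L) (ε : ℤ) (θ : anemicHeckeRing L 2 →+* ZMod (ℓ ^ n)),
        rad a b c / p ∣ L ∧ L ∣ (rad a b c / p) ^ 2 ∧ (ε = 1 ∨ ε = -1) ∧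
        θ (@anemicHeckeRing.T L hL 2 p ⟨hp.ne_zero⟩ hp hpL) =
          ((ε * (p + 1) : ℤ) : ZMod (ℓ ^ n)) := by
  sorry

/-- **Stub — C⁺ from the two named facts** (the conditional composition, registered as a stub so
that its proof lands under `Theorems/` as a `--supports` file; it carries the unconditional First
lemma `modulus_le_pow_of_ringHom`: a ring map `θ : 𝕋(N) → ℤ/m` with `θ(T_p) = x`, `|x| > B ≥`
all eigenvalue norms of `T_p` on `S_k(Γ₀(N))`, forces `m ≤ (|x|+B)^(rank_ℝ S_k(Γ₀(N)))`).
Deligne's bound and deep level lowering in trace form (expanded verbatim) imply C⁺ (expanded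
verbatim). -/
theorem stub_depthCostsHasseWindowOfFacts (hD : Deligne1974_heckeT_eigenvalue_norm_le)
    (hLL : ∀ a b c : ℕ, IsABCTriple a b c → a % 4 = 3 → 32 ∣ b →
      ∀ (p : ℕ) (hp : p.Prime), p ≠ 2 → p ∣ a * b * c →
      ∀ ℓ : ℕ, ℓ.Prime → 5 ≤ ℓ → ¬ ℓ ∣ a * b * c →
      ∀ n : ℕ, 0 < n → ℓ ^ n ∣ (a * b * c).factorization p →
        ∃ (L : ℕ) (hL : NeZero L) (hpL : ¬ p ∣ L) (ε : ℤ) (θ : anemicHeckeRing L 2 →+* ZMod (ℓ ^ n)),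
          rad a b c / p ∣ L ∧ L ∣ (rad a b c / p) ^ 2 ∧ (ε = 1 ∨ ε = -1) ∧
          θ (@anemicHeckeRing.T L hL 2 p ⟨hp.ne_zero⟩ hp hpL) =
            ((ε * (p + 1) : ℤ) : ZMod (ℓ ^ n))) :
    ∀ a b c : ℕ, IsABCTriple a b c → a % 4 = 3 → 32 ∣ b →
      ∀ p : ℕ, p.Prime → p ≠ 2 → p ∣ a * b * c →
      ∀ ℓ : ℕ, ℓ.Prime → 5 ≤ ℓ → ¬ ℓ ∣ a * b * c →
      ∀ n : ℕ, ℓ ^ n ∣ (a * b * c).factorization p →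
        ((ℓ ^ n : ℕ) : ℝ) ≤
          (1 + Real.sqrt p) ^ (2 * Module.finrank ℝ (CuspForm (Gamma0 ((rad a b c / p) ^ 2)) 2)) :=
  -- LANDED: Theorems/CongruentialReceptacleReceptacleIdentityStubDepthCostsHasseWindowOfFacts.lean (p98991),
  -- together with the unconditional First lemma `modulus_le_pow_of_ringHom`
  Summit.ABC.ABC.Theorems.ReceptacleIdentitySketch.stub_depthCostsHasseWindowOfFacts hD hLL

/-! ### Composition (sorry-free apart from the two named-fact stubs) -/

/-- **The line's composition: C⁺ from the stubs** — the conditional stub fed with the two named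
facts.  (Mechanism, proved in the landed stub files: for `n = 0` nothing to prove; otherwise deep
level lowering gives `θ : 𝕋(L) → ℤ/ℓⁿ` with `θ(T_p) = ε(p+1)` at a level `N/p ∣ L ∣ (N/p)²`,
Deligne bounds the eigenvalues of `T_p` on `S₂(Γ₀(L))` by `2√p < p + 1`, the First lemma gives
`ℓⁿ ≤ (p+1+2√p)^(rank L) = (1+√p)^(2 rank L)`, and the rank is monotone in the level.) -/
theorem DepthCostsHasseWindow_of : DepthCostsHasseWindow :=
  stub_depthCostsHasseWindowOfFacts stub_deligneWeightTwo stub_freyDeepLevelLoweringTrace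

end

end Summit.ABC.ABC.Cruxes.ReceptacleIdentity.Sketch
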